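import Summits.ResolutionOfSingularities.ResolutionOfSingularities.Theorems.HomologicalConductorNoZenoSplitGaloisRoots

/-!
# Galois splitting base, II: the ring of roots is finite étale and is the integral closure

W4.4 (crux `NoZenoR`, stmt-ResolutionOfSingularities-19943), slot 5 `stub_L1wCoreF`, brick
**D2″ (Galois refinement of the splitting base)**, ring side, part 2 of 3 (part 1:
`…SplitGaloisRoots`). For `D` an integrally closed LOCAL domain with fraction field `K`,
`f ∈ D[X]` monic with separable reduction, and `L ⊇ K` a field in which `f` splits and which is
generated over `K` by the roots (a splitting field of `f` over `K`):

* `etale_adjoin_rootSet` — `D[α₁, …, αₙ] ⊆ L` is ÉTALE over `D` (the inverses `f′(αⱼ)⁻¹` of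
  the iterated chart already lie in `D[α⃗]`), and `finite_adjoin_rootSet` — module-finite;
* `adjoin_rootSet_eq_integralClosure` — `D[α₁, …, αₙ]` IS the integral closure of `D` in `L`
  (étale over normal is normal: the tree's `mem_range_of_isIntegral_of_etale`, after clearing
  denominators `exists_smul_mem_adjoin_rootSet`);
* `etale_integralClosure`, `finite_integralClosure` — hence Mathlib's AKLB frame
  (`integralClosure D L`, `galRestrict`, `Algebra.isInvariant_of_isGalois`) applies to a FINITE
  ÉTALE `D`-algebra; `adjoin_rootSet_eq_top_of_isSplittingField`,
  `splits_map_of_isSplittingField` discharge the two hypotheses from `IsSplittingField`.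

Everything is PROVED; no definitions, no named facts. All statements are [folklore]
(Bourbaki, *Alg. Comm.* V §2; EGA IV 18.4; The Stacks Project, Tag 033C).

OURS (cell res-hironaka, chain W4.4); AI-written, weaker than expert review; nothing here is a
statement of the manuscript under review.
-/

noncomputable section

set_option linter.dupNamespace false

open Polynomial

namespace Summit.ResolutionOfSingularities.ResolutionOfSingularities.Theorems.NoZeno.SplittingBase

universe u

/-! ## The ring of roots `D[α₁, …, αₙ]` is finite étale and is the integral closure -/

section RingOfRoots

variable {D L : Type u} [CommRing D] [IsDomain D] [IsIntegrallyClosed D] [IsLocalRing D]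
  [Field L] [Algebra D L]

omit [IsDomain D] [IsIntegrallyClosed D] [IsLocalRing D] in
/-- The roots of the monic `f` are integral, so `D[α₁, …, αₙ] ⊆` the integral closure.
[folklore] -/
theorem rootSet_subset_integralClosure {f : D[X]} (hf : f.Monic) :
    f.rootSet L ⊆ (integralClosure D L : Set L) := by
  intro β hβ
  have hβ' := (mem_rootSet'.mp hβ).2
  show IsIntegral D β
  exact ⟨f, hf, by rw [← aeval_def]; exact hβ'⟩

omit [IsDomain D] [IsIntegrallyClosed D] [IsLocalRing D] in
/-- `D[α₁, …, αₙ]` is module-finite over `D`. [folklore] -/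
theorem finite_adjoin_rootSet {f : D[X]} (hf : f.Monic) :
    Module.Finite D (Algebra.adjoin D (f.rootSet L)) :=
  Algebra.finite_adjoin_of_finite_of_isIntegral (Polynomial.rootSet_finite f L)
    fun _ hx => rootSet_subset_integralClosure hf hx

omit [IsDomain D] [IsIntegrallyClosed D] [IsLocalRing D] in
/-- `D[α₁, …, αₙ]` is integral over `D`. [folklore] -/
theorem isIntegral_adjoin_rootSet {f : D[X]} (hf : f.Monic) :
    Algebra.IsIntegral D (Algebra.adjoin D (f.rootSet L)) :=
  haveI := finite_adjoin_rootSet (L := L) hf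
  Algebra.IsIntegral.of_finite D _

/-- **`D[α₁, …, αₙ]` is étale over `D`** (for `D` an integrally closed local domain, `f` monic
splitting in `L` with separable reduction): it is the iterated étale chart of the roots, the
inverses `f′(αⱼ)⁻¹` being already in `D[α⃗]`. [folklore] -/
theorem etale_adjoin_rootSet {f : D[X]} (hinj : Function.Injective (algebraMap D L))
    (hf : f.Monic) (hsplit : (f.map (algebraMap D L)).Splits)
    (hsep : (f.map (IsLocalRing.residue D)).Separable) :
    Algebra.Etale D (Algebra.adjoin D (f.rootSet L)) := by
  classical
  haveI := isIntegral_adjoin_rootSet (L := L) hf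
  set s : Finset L := (f.rootSet L).toFinset with hs
  have hscoe : (s : Set L) = f.rootSet L := by rw [hs, Set.coe_toFinset]
  have hsimple : ∀ θ ∈ s, aeval θ f = 0 ∧ aeval θ (derivative f) ≠ 0 := by
    intro θ hθ
    have hθ' : θ ∈ f.rootSet L := by rw [← hscoe]; exact Finset.mem_coe.mpr hθ
    exact ⟨(mem_rootSet'.mp hθ').2, aeval_derivative_ne_zero hf hsplit hsep hθ'⟩
  have het := etale_adjoin_simpleRoots hinj f s hsimple
  have heq : Algebra.adjoin D ((s : Set L) ∪
      (fun θ => (aeval θ (derivative f))⁻¹) '' (s : Set L)) = Algebra.adjoin D (f.rootSet L) := by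
    rw [hscoe]
    apply le_antisymm
    · refine Algebra.adjoin_le ?_
      rintro x (hx | ⟨θ, hθ, rfl⟩)
      · exact Algebra.subset_adjoin hx
      · exact inv_aeval_derivative_mem hf hsplit hsep _ Algebra.subset_adjoin hθ
    · exact Algebra.adjoin_mono Set.subset_union_left
  haveI := het
  exact Algebra.Etale.of_equiv (Subalgebra.equivOfEq _ _ heq)

omit [IsIntegrallyClosed D] in
/-- Clearing denominators: if `L` is generated over `K = Frac D` by the roots of `f`, every
`z ∈ L` has `d z ∈ D[α₁, …, αₙ]` for some nonzero `d ∈ D`. [folklore] -/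
theorem exists_smul_mem_adjoin_rootSet {K : Type u} [Field K] [Algebra D K] [IsFractionRing D K]
    [Algebra K L] [IsScalarTower D K L] {f : D[X]}
    (htop : Algebra.adjoin K (f.rootSet L) = ⊤) (z : L) :
    ∃ d : D, d ≠ 0 ∧ algebraMap D L d * z ∈ Algebra.adjoin D (f.rootSet L) := by
  set B₀ := Algebra.adjoin D (f.rootSet L) with hB₀
  -- the set of such `z` is a `K`-subalgebra containing the roots
  let M : Subalgebra K L :=
    { carrier := {z | ∃ d : D, d ≠ 0 ∧ algebraMap D L d * z ∈ B₀}
      mul_mem' := by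
        rintro x y ⟨d, hd, hx⟩ ⟨e, he, hy⟩
        refine ⟨d * e, mul_ne_zero hd he, ?_⟩
        have : algebraMap D L (d * e) * (x * y) =
            (algebraMap D L d * x) * (algebraMap D L e * y) := by rw [map_mul]; ring
        rw [this]
        exact B₀.mul_mem hx hy
      one_mem' := ⟨1, one_ne_zero, by rw [map_one, one_mul]; exact B₀.one_mem⟩
      add_mem' := by
        rintro x y ⟨d, hd, hx⟩ ⟨e, he, hy⟩
        refine ⟨d * e, mul_ne_zero hd he, ?_⟩
        have : algebraMap D L (d * e) * (x + y) =
            algebraMap D L e * (algebraMap D L d * x) +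
              algebraMap D L d * (algebraMap D L e * y) := by rw [map_mul]; ring
        rw [this]
        exact B₀.add_mem (B₀.mul_mem (B₀.algebraMap_mem e) hx)
          (B₀.mul_mem (B₀.algebraMap_mem d) hy)
      zero_mem' := ⟨1, one_ne_zero, by rw [mul_zero]; exact B₀.zero_mem⟩
      algebraMap_mem' := by
        intro c
        obtain ⟨a, b, hb, rfl⟩ := IsFractionRing.div_surjective (A := D) c
        refine ⟨b, nonZeroDivisors.ne_zero hb, ?_⟩
        have hb' : algebraMap D L b ≠ 0 := by
          rw [IsScalarTower.algebraMap_apply D K L]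
          exact (_root_.map_ne_zero _).mpr
            ((map_ne_zero_iff _ (IsFractionRing.injective D K)).mpr (nonZeroDivisors.ne_zero hb))
        have : algebraMap D L b * algebraMap K L (algebraMap D K a / algebraMap D K b) =
            algebraMap D L a := by
          rw [map_div₀, ← IsScalarTower.algebraMap_apply, ← IsScalarTower.algebraMap_apply,
            mul_div_cancel₀ _ hb']
        rw [this]
        exact B₀.algebraMap_mem a }
  have hle : Algebra.adjoin K (f.rootSet L) ≤ M := by
    refine Algebra.adjoin_le fun x hx => ?_
    exact ⟨1, one_ne_zero, by rw [map_one, one_mul]; exact Algebra.subset_adjoin hx⟩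
  have hz : z ∈ M := by
    apply hle; rw [htop]; exact Algebra.mem_top
  exact hz

/-- **`D[α₁, …, αₙ]` is the integral closure of `D` in the splitting field.** For `D` an
integrally closed local domain with fraction field `K`, `f ∈ D[X]` monic with separable reduction
and `L ⊇ K` generated by the roots of `f` (e.g. a splitting field of `f` over `K`): the integral
closure of `D` in `L` is `D[α₁, …, αₙ]` (étale over normal is normal, and an element of
`Frac(D) · D[α⃗]` integral over `D[α⃗]` lies in `D[α⃗]`). [folklore] -/
theorem adjoin_rootSet_eq_integralClosure {K : Type u} [Field K] [Algebra D K]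
    [IsFractionRing D K] [Algebra K L] [IsScalarTower D K L] {f : D[X]} (hf : f.Monic)
    (hsplit : (f.map (algebraMap D L)).Splits)
    (hsep : (f.map (IsLocalRing.residue D)).Separable)
    (htop : Algebra.adjoin K (f.rootSet L) = ⊤) :
    Algebra.adjoin D (f.rootSet L) = integralClosure D L := by
  have hinj : Function.Injective (algebraMap D L) := by
    rw [IsScalarTower.algebraMap_eq D K L]
    exact (algebraMap K L).injective.comp (IsFractionRing.injective D K)
  set B₀ := Algebra.adjoin D (f.rootSet L) with hB₀
  haveI : Algebra.Etale D B₀ := etale_adjoin_rootSet hinj hf hsplit hsep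
  apply le_antisymm
  · exact Algebra.adjoin_le (rootSet_subset_integralClosure hf)
  · intro z hz
    have hzD : IsIntegral D z := hz
    have hzB : IsIntegral B₀ z := hzD.tower_top
    obtain ⟨d, hd, hdz⟩ := exists_smul_mem_adjoin_rootSet htop z
    have hzt : algebraMap D L d * z = algebraMap B₀ L ⟨_, hdz⟩ := rfl
    obtain ⟨y, hy⟩ := Literature.AlgebraicGeometry.Resolution.mem_range_of_isIntegral_of_etale
      (R := D) (T := B₀) (L := L) hinj Subtype.val_injective hzB hd hzt
    rw [← hy]
    exact y.2

/-- In the situation of `adjoin_rootSet_eq_integralClosure`: **the integral closure of `D` in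
`L` is (finite) étale over `D`.** [folklore] -/
theorem etale_integralClosure {K : Type u} [Field K] [Algebra D K]
    [IsFractionRing D K] [Algebra K L] [IsScalarTower D K L] {f : D[X]} (hf : f.Monic)
    (hsplit : (f.map (algebraMap D L)).Splits)
    (hsep : (f.map (IsLocalRing.residue D)).Separable)
    (htop : Algebra.adjoin K (f.rootSet L) = ⊤) :
    Algebra.Etale D (integralClosure D L) := by
  have hinj : Function.Injective (algebraMap D L) := by
    rw [IsScalarTower.algebraMap_eq D K L]
    exact (algebraMap K L).injective.comp (IsFractionRing.injective D K)
  haveI := etale_adjoin_rootSet hinj hf hsplit hsep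
  exact Algebra.Etale.of_equiv
    (Subalgebra.equivOfEq _ _ (adjoin_rootSet_eq_integralClosure hf hsplit hsep htop))

/-- In the situation of `adjoin_rootSet_eq_integralClosure`: the integral closure of `D` in
`L` is module-finite over `D`. [folklore] -/
theorem finite_integralClosure {K : Type u} [Field K] [Algebra D K]
    [IsFractionRing D K] [Algebra K L] [IsScalarTower D K L] {f : D[X]} (hf : f.Monic)
    (hsplit : (f.map (algebraMap D L)).Splits)
    (hsep : (f.map (IsLocalRing.residue D)).Separable)
    (htop : Algebra.adjoin K (f.rootSet L) = ⊤) :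
    Module.Finite D (integralClosure D L) := by
  haveI := finite_adjoin_rootSet (L := L) hf
  exact Module.Finite.equiv
    (Subalgebra.equivOfEq _ _ (adjoin_rootSet_eq_integralClosure hf hsplit hsep htop)).toLinearEquiv

omit [IsDomain D] [IsIntegrallyClosed D] [IsLocalRing D] in
/-- For a splitting field `L` of `f` over `K`, the roots of `f` generate `L` over `K` (the
hypothesis `htop` above, from Mathlib's `IsSplittingField.adjoin_rootSet`). [folklore] -/
theorem adjoin_rootSet_eq_top_of_isSplittingField {K : Type u} [Field K] [Algebra D K]
    [Algebra K L] [IsScalarTower D K L] (f : D[X])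
    [Polynomial.IsSplittingField K L (f.map (algebraMap D K))] :
    Algebra.adjoin K (f.rootSet L) = ⊤ := by
  classical
  have h := Polynomial.IsSplittingField.adjoin_rootSet L (f.map (algebraMap D K))
  have hrs : (f.map (algebraMap D K)).rootSet L = f.rootSet L := by
    rw [rootSet_def, rootSet_def, aroots_def, aroots_def, Polynomial.map_map,
      ← IsScalarTower.algebraMap_eq]
  rwa [hrs] at h

omit [IsDomain D] [IsIntegrallyClosed D] [IsLocalRing D] in
/-- For a splitting field `L` of `f` over `K`, `f` splits in `L` (the hypothesis `hsplit`
above). [folklore] -/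
theorem splits_map_of_isSplittingField {K : Type u} [Field K] [Algebra D K]
    [Algebra K L] [IsScalarTower D K L] (f : D[X])
    [Polynomial.IsSplittingField K L (f.map (algebraMap D K))] :
    (f.map (algebraMap D L)).Splits := by
  have h := Polynomial.IsSplittingField.splits L (f.map (algebraMap D K))
  rwa [Polynomial.map_map, ← IsScalarTower.algebraMap_eq] at h

end RingOfRoots

end Summit.ResolutionOfSingularities.ResolutionOfSingularities.Theorems.NoZeno.SplittingBase

end
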